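import Mathlib.FieldTheory.Finite.Basic
import Mathlib.FieldTheory.Galois.Infinite
import Mathlib.FieldTheory.Galois.Profinite
import Mathlib.GroupTheory.Coset.Card
import Mathlib.LinearAlgebra.Matrix.GeneralLinearGroup.Card
import Mathlib.LinearAlgebra.Matrix.GeneralLinearGroup.Projective
import Mathlib.NumberTheory.Cyclotomic.Gal
import Mathlib.NumberTheory.LegendreSymbol.Basic
import Mathlib.NumberTheory.LegendreSymbol.QuadraticChar.Basic
import HarnessLib

/-!
# Newton–Thorne, *Symmetric power functoriality, II*: the printed proof of Thm. A; Lemma 3.8 and the elementary steps of Props. 3.7, 3.9 proved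
(companion to `Literature.NumberTheory.Automorphic.Sweep1SymmetricPower`, which states Thm. A of
the source — at the unramified places, on the tree's unitary `L²_cusp` objects — as the named fact
`Literature.NumberTheory.Automorphic.NewtonThorne2021_exists_cuspidal_symmPowerLift`, and to
`…Sweep1SymmetricPowerProofs` / `…Sweep1SymmetricPowerGelbartHolds`, which prove that fact
unconditionally equivalent to **lang.S24** `Literature.NumberTheory.Automorphic.exists_cuspidal_symmetricPower`)

J. Newton, J. A. Thorne, *Symmetric power functoriality for holomorphic modular forms, II*,
Publ. Math. IHÉS **134** (2021), 117–152 (= arXiv:2009.07180v2) [NewtonThorneIHES2021b].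
Page numbers below are those of the arXiv version.

## The printed proof of Thm. A (= Thm. 3.1, p. 20), restated

Thm. A: *for `π` a non-CM regular algebraic cuspidal automorphic representation of `GL₂(𝔸_ℚ)`
and `n ≥ 1`, `Symⁿ⁻¹ π` exists (regular algebraic, cuspidal, on `GL_n(𝔸_ℚ)`).*  Every line of the
proof is a statement about the `p`-adic Galois representations `r_{π,ι} : G_ℚ → GL₂(ℚ̄_p)`
attached to `π` and their residual images (§1, p. 4).

1. **Induction on `|sc(π)|`** (p. 20), `sc(π)` = the primes `p` with `π_p` supercuspidal.
   Base case `sc(π) = ∅`: the main theorem of part I [NewtonThorneIHES2021a, Thm. 2]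
   (analytic continuation of `Symⁿ⁻¹` along the Coleman–Mazur eigencurve, level raising for
   definite unitary groups, endoscopic classification).
2. **Induction step** (Prop. 3.10, p. 25; Prop. 3.11, p. 26): remove `p ∈ sc(π)`, `p ≥ 5`, by a
   congruence modulo `p` to a representation `π'` with `sc(π') = sc(π) ∖ {p}` (Lemma 3.5, p. 22,
   Prop. 3.7, p. 23, "seasoned" representations, Def. 3.6), and transfer the existence of
   `Symⁿ⁻¹` across the congruence with the **automorphy lifting theorem Thm. 2.1** (p. 5) for
   `Symⁿ⁻¹ r_{π,ι}` (weight `2`, non-ordinary at `p`, projective residual image between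
   `PSL₂(𝔽_{p^a})` and `PGL₂(𝔽_{p^a})`, `p^a > max(5, 2n − 1)`); Thm. 2.1 is proved in §2 by base
   change to a CM field, a morphism `P → R` from the universal pseudodeformation ring to the
   universal deformation ring, Taylor–Wiles–Kisin patching (Props. 2.3, 2.5, 2.6, 2.8) and the
   regularity of `Spec P` at the point `Symⁿ⁻¹ r_{π',ι}` [NT20].
3. **Auxiliary primes** (Props. 3.9 and 3.11, pp. 24–27): primes `q, t, r, s` whose Frobenius
   elements act in a prescribed way on the composita of `ℚ̄^{ker Proj r̄_{π,ι}}` with cyclotomic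
   fields; "using the Chebotarev density theorem, we see that it is equivalent to exhibit Galois
   automorphisms acting in the correct way.  In order to do so, it is helpful to recall the
   following lemma from basic Galois theory" — **Lemma 3.8** (p. 24), proved in this file.
4. **Conclusion** (pp. 26–27): weight `k > 2 ↦` weight `2` (Lemma 3.4, via types [BM02] and
   quaternion algebras), [Gee11, Cor. 3.1.7], potential diagonalizability and
   [BLGGT14, Thm. 4.2.1], [KW09a, Lemma 6.3].

What the tree has (2026-08): the `Symᵐ : GL₂ → GL_{m+1}` brick
(`Literature/RepresentationTheory/AlgebraicGroups/SL2SymPower`), the Satake-parameter shell and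
the reductions of `Sweep1SymmetricPower*` (newform dictionary, `m = 1`, uniqueness by strong
multiplicity one, lang.S24 `↔` the fact), an `Eigenvariety` *interface* (`Automorphic/Eigenvariety`,
no existence theorem), and the Galois representations attached to newforms / regular algebraic
`π` only as the *unproved* named facts
`Literature.NumberTheory.EllipticCurves.ModularForms.Ribet1977.thm21_exists_galoisRep` and
`Literature.NumberTheory.Automorphic.exists_galoisRep_of_regularAlgebraic`.  Absent: Galois
(pseudo)deformation rings, patching, any automorphy lifting theorem, eigenvariety existence,
automorphic forms on unitary groups, the local Langlands correspondence as a theorem.  Hence the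
fact is not discharged here; this file proves the one numbered result of §3 whose objects exist.

## Lemma 3.8, as proved here

Printed statement (p. 24): *Let `E/K` be a finite Galois extension, and let `K₁/K`, `K₂/K` be
Galois subextensions.  Then the natural map
`Gal(K₁K₂/K) → Gal(K₁/K) ×_{Gal(K₁ ∩ K₂/K)} Gal(K₂/K)` is an isomorphism.*

We prove it for a Galois extension `E/K` of **any** degree (Krull topology; the finite case is
the printed one, and the infinite case `E = ℚ̄` is how it is used with Chebotarev), for
intermediate fields `K₁, K₂` normal over `K`, phrased through the ambient group `Gal(E/K)`
(which surjects onto `Gal(K₁K₂/K)`), so that no tower instances on `↥(K₁ ⊔ K₂)` are needed: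

* `NewtonThorne2021.fixingSubgroup_inf_eq_sup`: `Gal(E/K₁ ∩ K₂) = Gal(E/K₁) · Gal(E/K₂)` inside
  `Gal(E/K)` (closed-subgroup Galois correspondence; needs only `K₁/K` normal);
* `NewtonThorne2021.restrictProdHom K₁ K₂ : Gal(E/K) →* Gal(K₁/K) × Gal(K₂/K)`, its kernel
  `= Gal(E/K₁K₂)` (`ker_restrictProdHom`) and its range `=` the fibre product, i.e. the pairs
  `(σ₁, σ₂)` that agree on `K₁ ∩ K₂` (`mem_range_restrictProdHom_iff`) — together the printed
  isomorphism, packaged as `quotientFixingSubgroupSupEquivRange :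
  Gal(E/K) ⧸ Gal(E/K₁K₂) ≃* range` and, composed with `Gal(K₁K₂/K) ≃ Gal(E/K) ⧸ Gal(E/K₁K₂)`,
  `galSupEquivRange : Gal(K₁K₂/K) ≃* range`;
* the working form `NewtonThorne2021.exists_restrictNormal_eq`: automorphisms `σ₁` of `K₁/K`
  and `σ₂` of `K₂/K` that agree on `K₁ ∩ K₂` are simultaneously induced by one `σ ∈ Gal(E/K)`,
  unique up to `Gal(E/K₁K₂)` (`restrictNormal_eq_and_iff`).

[cite: NewtonThorneIHES2021b, Lemma 3.8 (p. 24 of arXiv:2009.07180 = p. 140 of the journal)]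

## Proof of Prop. 3.7, the group-theoretic step (p. 24)

*"If `q^a ≤ 2n − 1` then `q^{2a} − 1 ≤ 4n(n − 1)`, so every element of `PGL₂(𝔽_{q^a})` of order
prime to `q` has order at most `4n(n − 1)`"*: `NewtonThorne2021.orderOf_le_of_card_le_two_mul_sub_one`,
from `natCard_projGenLinGroup_fin_two` (`|PGL₂(𝔽_Q)| = Q(Q² − 1)`, Lagrange with
`Matrix.card_GL_field` and the centre `= ` scalars) and `orderOf_dvd_card_sq_sub_one` (order
prime to the characteristic `⇒` order `∣ Q² − 1`).

## Proof of Prop. 3.7, the elementary arithmetic (pp. 23–24)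

The case `p = q` of the proof of Prop. 3.7 runs on explicit arithmetic with the data of a
"seasoned" representation (Def. 3.6: primes `q, t` with `t ∣ q + 1`, `t > max(10, 8n(n − 1))`,
`b = (q + 1)/t > 2`, the exponent `a ∈ {1, …, t − 1}` of the tame inertial character and
`a(q − 1)b = i + (q + 1)j`, `i ∈ {1, …, q}`).  Section `Prop37Arith` proves each printed deduction:
`t ∤ q − 1`; existence of `i, j`; `b ∣ i`; *"neither `i` nor `i − 2` can be divisible by `q − 1`"*;
hence `r^{i−1} ∉ {r, r⁻¹}` for `r` of order `q − 1` (the contradiction proving `r̄_{π,ι}`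
irreducible); the choice of `a` with `i = b`; the three element orders
`(q + 1)/gcd(q + 1, b ± 1)`, `(q − 1)/gcd(q − 1, b − 1)` are `≥ t/2`; and the closing inequality
`|𝔽_{q^a}| > 2n − 1` (`NewtonThorne2021.prop37_*`).

## Proof of Prop. 3.9, the image of complex conjugation (p. 24)

*"The condition `t ≡ 1 mod 4` implies that `−1 mod t` is a square and that the image of complex
conjugation `c` in `G` lies in `[G, G]`"* (`G = Proj r̄_{π,ι}(G_ℚ)`, conjugate to `PSL₂(𝔽_t)` or
`PGL₂(𝔽_t)`; `det r̄_{π,ι}(c) = −1`).  Section `Prop39` proves the group theory: the image of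
`g ∈ GL₂(F)` in `PGL₂(F)` lies in the image of `SL₂(F)` iff `det g` is a square
(`mk_mem_range_toPGL_iff`); that image lies in `[G, G]` for every subgroup `G ⊇ im SL₂(F)` once
`|F| ≥ 4` (`range_toPGL_le_commutator`, from Mathlib's `Matrix.SL2.commutator_eq_top`); hence the
printed sentence for `|F| ≡ 1 mod 4`, `det g = −1` (`prop39_mk_mem_commutator`); and, for the
"form of the image" used on p. 25 (*"`Gal(E₂/E₂^{ab})` is a non-abelian simple group"*), the
determinant modulo squares `detModSq : PGL₂(F) →* Fˣ/(Fˣ)²` (surjective, kernel `= im SL₂(F)`,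
`ker_detModSq`) and `[PGL₂(F), PGL₂(F)] = im SL₂(F)` (`commutator_eq_range_toPGL`), of index `2`
for `F` finite of odd characteristic (`index_range_toPGL`, the squares having index `2` in `Fˣ`,
`index_range_powMonoidHom_two`), while `im SL₂(F)` is perfect (`commutator_range_toPGL`) — the
printed "degree 1 or 2" of `E₂^{ab}`.  The simplicity of `PSL₂(𝔽_t)`, `t > 3`, invoked in the same
paragraphs, is Mathlib's `Matrix.ProjectiveSpecialLinearGroup.rank_two_simple`.  Finally
(section `Prop39Cyclotomic`) the p. 25 sentence *"`c` acts trivially on the quadratic subfield of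
`ℚ(ζ_t)` (since `t ≡ 1 mod 4`)"*: squares in a Galois group fix quadratic subextensions
(`mul_self_mem_fixingSubgroup_of_finrank_eq_two`), and `ζ ↦ ζ⁻¹` is a square in
`Gal(ℚ(ζ_t)/ℚ) ≅ (ℤ/tℤ)ˣ` for `t ≡ 1 mod 4` (`prop39_inv_mem_fixingSubgroup`, via
`IsCyclotomicExtension.autEquivPow` and `ZMod.exists_sq_eq_neg_one_iff`); two further small steps
of p. 25 (`prop39_card_dvd_two`: a cyclic group of exponent `2` has order `∣ 2` — *"`E₁ ∩ ℚ(ζ_{p_i})`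
is either trivial or quadratic"*; `prop39_exists_sq_ne_one`: `(𝔽_pˣ)² ≠ 1` for `p ≥ 5`) and the
inequality `3^a > 2n − 1` of the proof of Thm. 3.1, p. 27 (`thm31_two_mul_sub_one_lt_card`) close
section `Prop39Misc`.

This file deliberately imports only Mathlib's Galois theory and matrix groups (not the
automorphic `L²` shell of `Sweep1SymmetricPower`), so that the `GaloisRepresentations/` files
running Chebotarev / large-image arguments can use these lemmas without importing adelic
analysis.
-/

noncomputable section

namespace Literature.NumberTheory.Automorphic

namespace NewtonThorne2021

open IntermediateField

variable {k K : Type*} [Field k] [Field K] [Algebra k K]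

/-- **Galois correspondence for an intersection with a normal subextension.**  For `K/k` Galois
(any degree), `K₁/k` a normal subextension and `K₂` any intermediate field,
`Gal(K/K₁ ∩ K₂) = Gal(K/K₁) ⊔ Gal(K/K₂)` (`= Gal(K/K₁) · Gal(K/K₂)`, a closed subgroup because
`Gal(K/K₁)` is compact and normal).  This is the group-theoretic content of
[cite: NewtonThorneIHES2021b, Lemma 3.8]. -/
theorem fixingSubgroup_inf_eq_sup [IsGalois k K] (K₁ K₂ : IntermediateField k K) [Normal k K₁] :
    (K₁ ⊓ K₂).fixingSubgroup = K₁.fixingSubgroup ⊔ K₂.fixingSubgroup := by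
  haveI : Algebra.IsSeparable k K₁ := Algebra.isSeparable_tower_bot_of_isSeparable k K₁ K
  haveI : IsGalois k K₁ := ⟨⟩
  refine le_antisymm ?_
    (sup_le (fixingSubgroup_le inf_le_left) (fixingSubgroup_le inf_le_right))
  have hclosed :
      IsClosed ((K₁.fixingSubgroup ⊔ K₂.fixingSubgroup : Subgroup Gal(K/k)) : Set Gal(K/k)) := by
    rw [Subgroup.normal_mul]
    exact (InfiniteGalois.fixingSubgroup_isClosed K₂).mul_left_of_isCompact
      (InfiniteGalois.fixingSubgroup_isClosed K₁).isCompact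
  have hle : fixedField (K₁.fixingSubgroup ⊔ K₂.fixingSubgroup) ≤ K₁ ⊓ K₂ :=
    le_inf ((fixedField_le le_sup_left).trans (InfiniteGalois.fixedField_fixingSubgroup K₁).le)
      ((fixedField_le le_sup_right).trans (InfiniteGalois.fixedField_fixingSubgroup K₂).le)
  calc (K₁ ⊓ K₂).fixingSubgroup
      ≤ (fixedField (K₁.fixingSubgroup ⊔ K₂.fixingSubgroup)).fixingSubgroup := fixingSubgroup_le hle
    _ = K₁.fixingSubgroup ⊔ K₂.fixingSubgroup :=
        InfiniteGalois.fixingSubgroup_fixedField ⟨K₁.fixingSubgroup ⊔ K₂.fixingSubgroup, hclosed⟩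

/-- The natural map `Gal(K/k) → Gal(K₁/k) × Gal(K₂/k)`, `σ ↦ (σ|_{K₁}, σ|_{K₂})`, for normal
subextensions `K₁, K₂` of `K/k`; it factors through `Gal(K₁K₂/k)`
(`ker_restrictProdHom`). [cite: NewtonThorneIHES2021b, Lemma 3.8] -/
def restrictProdHom (K₁ K₂ : IntermediateField k K) [Normal k K₁] [Normal k K₂] :
    Gal(K/k) →* Gal(K₁/k) × Gal(K₂/k) :=
  (AlgEquiv.restrictNormalHom K₁).prod (AlgEquiv.restrictNormalHom K₂)

section

variable (K₁ K₂ : IntermediateField k K) [Normal k K₁] [Normal k K₂]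

/-- First component of `restrictProdHom`: restriction to `K₁`. [cite: NewtonThorneIHES2021b, Lemma 3.8] -/
@[simp] theorem restrictProdHom_apply_fst (σ : Gal(K/k)) :
    (restrictProdHom K₁ K₂ σ).1 = σ.restrictNormal K₁ := rfl

/-- Second component of `restrictProdHom`: restriction to `K₂`. [cite: NewtonThorneIHES2021b, Lemma 3.8] -/
@[simp] theorem restrictProdHom_apply_snd (σ : Gal(K/k)) :
    (restrictProdHom K₁ K₂ σ).2 = σ.restrictNormal K₂ := rfl

/-- The first component of `restrictProdHom σ` acts on `K₁ ⊂ K` as `σ` does.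
[cite: NewtonThorneIHES2021b, Lemma 3.8] -/
theorem coe_restrictProdHom_apply_fst (σ : Gal(K/k)) (x : K₁) :
    ((restrictProdHom K₁ K₂ σ).1 x : K) = σ x :=
  AlgEquiv.restrictNormal_commutes σ K₁ x

/-- The second component of `restrictProdHom σ` acts on `K₂ ⊂ K` as `σ` does.
[cite: NewtonThorneIHES2021b, Lemma 3.8] -/
theorem coe_restrictProdHom_apply_snd (σ : Gal(K/k)) (x : K₂) :
    ((restrictProdHom K₁ K₂ σ).2 x : K) = σ x :=
  AlgEquiv.restrictNormal_commutes σ K₂ x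

/-- **Injectivity half of Lemma 3.8**: the kernel of `σ ↦ (σ|_{K₁}, σ|_{K₂})` is `Gal(K/K₁K₂)`, so
the map factors through an injection of `Gal(K₁K₂/k) = Gal(K/k) ⧸ Gal(K/K₁K₂)`.
[cite: NewtonThorneIHES2021b, Lemma 3.8] -/
theorem ker_restrictProdHom : (restrictProdHom K₁ K₂).ker = (K₁ ⊔ K₂).fixingSubgroup := by
  rw [restrictProdHom, MonoidHom.ker_prod, IntermediateField.restrictNormalHom_ker,
    IntermediateField.restrictNormalHom_ker, fixingSubgroup_sup]

/-- Two automorphisms of `K/k` have the same restrictions to `K₁` and to `K₂` iff they differ by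
an element of `Gal(K/K₁K₂)`. [cite: NewtonThorneIHES2021b, Lemma 3.8] -/
theorem restrictNormal_eq_and_iff (σ τ : Gal(K/k)) :
    (σ.restrictNormal K₁ = τ.restrictNormal K₁ ∧ σ.restrictNormal K₂ = τ.restrictNormal K₂) ↔
      σ⁻¹ * τ ∈ (K₁ ⊔ K₂).fixingSubgroup := by
  rw [← ker_restrictProdHom, MonoidHom.mem_ker, map_mul, map_inv, inv_mul_eq_one, Prod.ext_iff]
  simp only [restrictProdHom_apply_fst, restrictProdHom_apply_snd]

/-- **The image in Lemma 3.8 is the fibre product**: a pair `(σ₁, σ₂) ∈ Gal(K₁/k) × Gal(K₂/k)` is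
of the form `(σ|_{K₁}, σ|_{K₂})` for some `σ ∈ Gal(K/k)` iff `σ₁` and `σ₂` agree on `K₁ ∩ K₂`
(equivalently, have the same image in `Gal(K₁ ∩ K₂/k)`).  Proof as in any textbook: lift `σᵢ` to
`gᵢ ∈ Gal(K/k)`; then `g₁⁻¹ g₂ ∈ Gal(K/K₁ ∩ K₂) = Gal(K/K₁) · Gal(K/K₂)`
(`fixingSubgroup_inf_eq_sup`), say `g₁⁻¹ g₂ = h₁ h₂`, and `σ = g₁ h₁ = g₂ h₂⁻¹` works.
[cite: NewtonThorneIHES2021b, Lemma 3.8] -/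
theorem mem_range_restrictProdHom_iff [IsGalois k K] (p : Gal(K₁/k) × Gal(K₂/k)) :
    p ∈ (restrictProdHom K₁ K₂).range ↔
      ∀ (x : K) (h₁ : x ∈ K₁) (h₂ : x ∈ K₂), (p.1 ⟨x, h₁⟩ : K) = p.2 ⟨x, h₂⟩ := by
  constructor
  · rintro ⟨σ, rfl⟩ x h₁ h₂
    rw [coe_restrictProdHom_apply_fst, coe_restrictProdHom_apply_snd]
  · intro h
    obtain ⟨g₁, hg₁⟩ := AlgEquiv.restrictNormalHom_surjective K p.1
    obtain ⟨g₂, hg₂⟩ := AlgEquiv.restrictNormalHom_surjective K p.2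
    have e₁ : ∀ x : K₁, (p.1 x : K) = g₁ x := fun x => by
      rw [← hg₁]; exact AlgEquiv.restrictNormalHom_apply K₁ g₁ x
    have e₂ : ∀ x : K₂, (p.2 x : K) = g₂ x := fun x => by
      rw [← hg₂]; exact AlgEquiv.restrictNormalHom_apply K₂ g₂ x
    have hmem : g₁⁻¹ * g₂ ∈ (K₁ ⊓ K₂).fixingSubgroup := by
      rw [IntermediateField.mem_fixingSubgroup_iff]
      intro x hx
      have hx' : g₂ x = g₁ x := by rw [← e₁ ⟨x, hx.1⟩, ← e₂ ⟨x, hx.2⟩]; exact (h x hx.1 hx.2).symm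
      rw [AlgEquiv.mul_apply, hx', AlgEquiv.aut_inv, AlgEquiv.symm_apply_apply]
    haveI : Algebra.IsSeparable k K₁ := Algebra.isSeparable_tower_bot_of_isSeparable k K₁ K
    haveI : IsGalois k K₁ := ⟨⟩
    rw [fixingSubgroup_inf_eq_sup K₁ K₂, ← SetLike.mem_coe, Subgroup.normal_mul] at hmem
    obtain ⟨h₁, hh₁, h₂, hh₂, hprod⟩ := Set.mem_mul.mp hmem
    have hh₁' := (IntermediateField.mem_fixingSubgroup_iff _ _).mp hh₁
    have hh₂' := (IntermediateField.mem_fixingSubgroup_iff _ _).mp (inv_mem hh₂)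
    have hστ : g₁ * h₁ = g₂ * h₂⁻¹ := by
      rw [eq_mul_inv_iff_mul_eq, mul_assoc, hprod, mul_inv_cancel_left]
    refine ⟨g₁ * h₁, Prod.ext ?_ ?_⟩
    · apply AlgEquiv.ext
      intro x
      apply Subtype.val_injective
      change ((restrictProdHom K₁ K₂ (g₁ * h₁)).1 x : K) = p.1 x
      rw [coe_restrictProdHom_apply_fst, AlgEquiv.mul_apply, hh₁' x x.2, e₁]
    · apply AlgEquiv.ext
      intro x
      apply Subtype.val_injective
      change ((restrictProdHom K₁ K₂ (g₁ * h₁)).2 x : K) = p.2 x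
      rw [hστ, coe_restrictProdHom_apply_snd, AlgEquiv.mul_apply, hh₂' x x.2, e₂]

/-- **Lemma 3.8, working form.**  Automorphisms `σ₁ ∈ Gal(K₁/k)`, `σ₂ ∈ Gal(K₂/k)` of two normal
subextensions of a Galois extension `K/k` that agree on `K₁ ∩ K₂` are the restrictions of a
single `σ ∈ Gal(K/k)` (unique up to `Gal(K/K₁K₂)`, `restrictNormal_eq_and_iff`).  With `K = ℚ̄`
and Chebotarev this is how the auxiliary primes of Props. 3.9 and 3.11 are produced.
[cite: NewtonThorneIHES2021b, Lemma 3.8 and proof of Prop. 3.9] -/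
theorem exists_restrictNormal_eq [IsGalois k K] (σ₁ : Gal(K₁/k)) (σ₂ : Gal(K₂/k))
    (h : ∀ (x : K) (h₁ : x ∈ K₁) (h₂ : x ∈ K₂), (σ₁ ⟨x, h₁⟩ : K) = σ₂ ⟨x, h₂⟩) :
    ∃ σ : Gal(K/k), σ.restrictNormal K₁ = σ₁ ∧ σ.restrictNormal K₂ = σ₂ := by
  obtain ⟨σ, hσ⟩ := (mem_range_restrictProdHom_iff K₁ K₂ (σ₁, σ₂)).mpr h
  exact ⟨σ, (Prod.ext_iff.mp hσ).1, (Prod.ext_iff.mp hσ).2⟩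

/-- Conversely, restrictions of one `σ` agree on `K₁ ∩ K₂` (the trivial direction of the
description of the image). [cite: NewtonThorneIHES2021b, Lemma 3.8] -/
theorem coe_restrictNormal_apply_eq (σ : Gal(K/k)) (x : K) (h₁ : x ∈ K₁) (h₂ : x ∈ K₂) :
    (σ.restrictNormal K₁ ⟨x, h₁⟩ : K) = σ.restrictNormal K₂ ⟨x, h₂⟩ :=
  (AlgEquiv.restrictNormal_commutes σ K₁ ⟨x, h₁⟩).trans
    (AlgEquiv.restrictNormal_commutes σ K₂ ⟨x, h₂⟩).symm

/-- For normal subextensions `K₁, K₂` of a Galois extension `K/k`, `Gal(K/K₁K₂)` is a normal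
subgroup of `Gal(K/k)` (`K₁K₂/k` is Galois). [cite: NewtonThorneIHES2021b, Lemma 3.8] -/
instance fixingSubgroup_sup_normal [IsGalois k K] : ((K₁ ⊔ K₂).fixingSubgroup).Normal :=
  haveI : IsGalois k (K₁ ⊔ K₂ : IntermediateField k K) :=
    { to_isSeparable := Algebra.isSeparable_tower_bot_of_isSeparable k _ K }
  IsGalois.fixingSubgroup_normal_of_isGalois _

/-- **Lemma 3.8 as an isomorphism, quotient form**: `Gal(K/k) ⧸ Gal(K/K₁K₂) ≃ ` the fibre product
`Gal(K₁/k) ×_{Gal(K₁ ∩ K₂/k)} Gal(K₂/k)` (realised as the range of `restrictProdHom`, identified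
with the fibre product by `mem_range_restrictProdHom_iff`). [cite: NewtonThorneIHES2021b, Lemma 3.8] -/
def quotientFixingSubgroupSupEquivRange [IsGalois k K] :
    Gal(K/k) ⧸ (K₁ ⊔ K₂).fixingSubgroup ≃* (restrictProdHom K₁ K₂).range :=
  (QuotientGroup.quotientMulEquivOfEq (ker_restrictProdHom K₁ K₂).symm).trans
    (QuotientGroup.quotientKerEquivRange _)

/-- `quotientFixingSubgroupSupEquivRange` is induced by `restrictProdHom`.
[cite: NewtonThorneIHES2021b, Lemma 3.8] -/
theorem quotientFixingSubgroupSupEquivRange_apply_mk [IsGalois k K] (σ : Gal(K/k)) :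
    (quotientFixingSubgroupSupEquivRange K₁ K₂ (QuotientGroup.mk σ) : Gal(K₁/k) × Gal(K₂/k)) =
      restrictProdHom K₁ K₂ σ := rfl

/-- `Gal(K/K₁K₂)` as a closed normal subgroup of `Gal(K/k)` (so that
`InfiniteGalois.normalAutEquivQuotient` applies). [cite: NewtonThorneIHES2021b, Lemma 3.8] -/
def fixingSubgroupSupClosed [IsGalois k K] : ClosedSubgroup Gal(K/k) :=
  ⟨(K₁ ⊔ K₂).fixingSubgroup, InfiniteGalois.fixingSubgroup_isClosed _⟩

/-- Normality of `fixingSubgroupSupClosed`. [cite: NewtonThorneIHES2021b, Lemma 3.8] -/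
instance fixingSubgroupSupClosed_normal [IsGalois k K] : (fixingSubgroupSupClosed K₁ K₂).Normal :=
  inferInstanceAs (K₁ ⊔ K₂).fixingSubgroup.Normal

/-- **Lemma 3.8 as printed**: `Gal(K₁K₂/k) ≃ Gal(K₁/k) ×_{Gal(K₁ ∩ K₂/k)} Gal(K₂/k)` — here for
`K/k` Galois of any degree, the fibre product being the range of `restrictProdHom`
(`mem_range_restrictProdHom_iff`); the printed Lemma is the case `[K : k] < ∞`.
[cite: NewtonThorneIHES2021b, Lemma 3.8 (p. 24)] -/
def galSupEquivRange [IsGalois k K] :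
    Gal((K₁ ⊔ K₂ : IntermediateField k K)/k) ≃* (restrictProdHom K₁ K₂).range :=
  ((AlgEquiv.autCongr (IntermediateField.equivOfEq
      (InfiniteGalois.fixedField_fixingSubgroup (K₁ ⊔ K₂)))).symm.trans
    (InfiniteGalois.normalAutEquivQuotient (fixingSubgroupSupClosed K₁ K₂)).symm).trans
    (quotientFixingSubgroupSupEquivRange K₁ K₂)

/-- Transport of "restriction of `σ` to `K₁K₂`" along the (propositional) identification
`fixedField Gal(K/K₁K₂) = K₁K₂` of the Galois correspondence. [folklore] -/
theorem autCongr_equivOfEq_restrictNormalHom [IsGalois k K] (σ : Gal(K/k)) :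
    AlgEquiv.autCongr
        (IntermediateField.equivOfEq (InfiniteGalois.fixedField_fixingSubgroup (K₁ ⊔ K₂)))
        (AlgEquiv.restrictNormalHom (fixedField (K₁ ⊔ K₂).fixingSubgroup) σ) =
      AlgEquiv.restrictNormalHom (K₁ ⊔ K₂ : IntermediateField k K) σ := by
  apply AlgEquiv.ext
  intro x
  apply Subtype.val_injective
  rw [AlgEquiv.autCongr_apply, AlgEquiv.trans_apply, AlgEquiv.trans_apply]
  change ((AlgEquiv.restrictNormalHom (fixedField (K₁ ⊔ K₂).fixingSubgroup) σ)
      ((IntermediateField.equivOfEq _).symm x) : K) = _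
  rw [AlgEquiv.restrictNormalHom_apply, AlgEquiv.restrictNormalHom_apply]
  rfl

/-- **`galSupEquivRange` is the natural map** of Lemma 3.8: on the restriction to `K₁K₂` of any
`σ ∈ Gal(K/k)` it is `(σ|_{K₁}, σ|_{K₂})` (and every element of `Gal(K₁K₂/k)` is such a
restriction, `AlgEquiv.restrictNormalHom_surjective`). [cite: NewtonThorneIHES2021b, Lemma 3.8] -/
theorem galSupEquivRange_apply_restrictNormalHom [IsGalois k K] (σ : Gal(K/k)) :
    (galSupEquivRange K₁ K₂ (AlgEquiv.restrictNormalHom (K₁ ⊔ K₂ : IntermediateField k K) σ) :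
      Gal(K₁/k) × Gal(K₂/k)) = restrictProdHom K₁ K₂ σ := by
  rw [← autCongr_equivOfEq_restrictNormalHom, galSupEquivRange, MulEquiv.trans_apply,
    MulEquiv.trans_apply, MulEquiv.symm_apply_apply]
  change ((quotientFixingSubgroupSupEquivRange K₁ K₂)
      ((InfiniteGalois.normalAutEquivQuotient (fixingSubgroupSupClosed K₁ K₂)).symm
        (InfiniteGalois.normalAutEquivQuotient (fixingSubgroupSupClosed K₁ K₂) σ)) :
      Gal(K₁/k) × Gal(K₂/k)) = _
  rw [MulEquiv.symm_apply_apply]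
  rfl

end

/-! ### Proof of Prop. 3.7: orders of elements of `PGL₂(𝔽_Q)` prime to the characteristic

In the proof of Prop. 3.7 (p. 24) the source argues: *"If `q^a ≤ 2n − 1` then
`q^{2a} − 1 ≤ 4n(n − 1)`, so every element of `PGL₂(𝔽_{q^a})` of order prime to `q` has order
at most `4n(n − 1)`.  Since `t/2 > 4n(n − 1)`, we see that we must have `q^a > 2n − 1`."*
The group-theoretic input — an element of `PGL₂(𝔽_Q)` of order prime to the characteristic has
order dividing `Q² − 1` — is proved here by Lagrange: `|PGL₂(𝔽_Q)| = Q(Q² − 1)` and `Q` is a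
power of the characteristic.  (The sharper "order divides `Q − 1` or `Q + 1`" is not needed for
the printed inequality.)  Mathlib: `Matrix.ProjGenLinGroup` (`PGL(2, F)`),
`Matrix.card_GL_field`, `Matrix.GeneralLinearGroup.center_eq_range_scalar`. -/

section Prop37

open scoped MatrixGroups

variable {F : Type*} [Field F] [Fintype F]

/-- For `n ≥ 1` the centre of `GL_n(F)` — the scalar matrices,
`Matrix.GeneralLinearGroup.center_eq_range_scalar` — has `|F| − 1` elements. [folklore] -/
theorem natCard_center_generalLinearGroup (n : ℕ) [NeZero n] :
    Nat.card (Subgroup.center (GL (Fin n) F)) = Fintype.card F - 1 := by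
  have hinj : Function.Injective
      (Matrix.GeneralLinearGroup.scalar (Fin n) : Fˣ →* GL (Fin n) F) := by
    intro u v h
    ext
    have h' := congrArg (fun g : GL (Fin n) F => (g : Matrix (Fin n) (Fin n) F) 0 0) h
    simpa using h'
  rw [Matrix.GeneralLinearGroup.center_eq_range_scalar,
    ← Nat.card_congr (MonoidHom.ofInjective hinj).toEquiv, Nat.card_units,
    Nat.card_eq_fintype_card]

/-- `|PGL₂(𝔽_Q)| = Q (Q² − 1)`. [folklore] -/
theorem natCard_projGenLinGroup_fin_two :
    Nat.card PGL(2, F) = Fintype.card F * (Fintype.card F ^ 2 - 1) := by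
  have hq : 1 < Fintype.card F := Fintype.one_lt_card
  have hL := (Subgroup.center (GL (Fin 2) F)).card_eq_card_quotient_mul_card_subgroup
  rw [Matrix.card_GL_field, natCard_center_generalLinearGroup, Fin.prod_univ_two] at hL
  simp only [Fin.val_zero, Fin.val_one, pow_zero, pow_one] at hL
  change _ = Nat.card PGL(2, F) * _ at hL
  have h2 : (Fintype.card F ^ 2 - 1) * (Fintype.card F ^ 2 - Fintype.card F) =
      Fintype.card F * (Fintype.card F ^ 2 - 1) * (Fintype.card F - 1) := by
    rw [show Fintype.card F ^ 2 - Fintype.card F = Fintype.card F * (Fintype.card F - 1) by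
      rw [Nat.mul_sub_one, sq]]
    ring
  rw [h2] at hL
  exact (Nat.eq_of_mul_eq_mul_right (by omega) hL).symm

/-- An element of `PGL₂(𝔽_Q)` whose order is prime to the characteristic `p` has order dividing
`Q² − 1` (Lagrange in `PGL₂(𝔽_Q)`, of order `Q(Q² − 1)`, `Q` a power of `p`). [folklore] -/
theorem orderOf_dvd_card_sq_sub_one (p : ℕ) [CharP F p] (x : PGL(2, F))
    (hx : (orderOf x).Coprime p) : orderOf x ∣ Fintype.card F ^ 2 - 1 := by
  obtain ⟨a, _, hcard⟩ := FiniteField.card F p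
  have hdvd : orderOf x ∣ Fintype.card F * (Fintype.card F ^ 2 - 1) := by
    rw [← natCard_projGenLinGroup_fin_two]
    exact orderOf_dvd_natCard x
  rw [hcard] at hdvd ⊢
  exact (Nat.Coprime.pow_right _ hx).dvd_of_dvd_mul_left hdvd

/-- **Newton–Thorne II, proof of Prop. 3.7 (p. 24), the group-theoretic step**: *"If
`q^a ≤ 2n − 1` then `q^{2a} − 1 ≤ 4n(n − 1)`, so every element of `PGL₂(𝔽_{q^a})` of order prime
to `q` has order at most `4n(n − 1)`."*  Here `F = 𝔽_{q^a}` is any finite field of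
characteristic `p` (the source's `q`) with `|F| ≤ 2n − 1`.
[cite: NewtonThorneIHES2021b, proof of Prop. 3.7 (p. 24 of arXiv:2009.07180)] -/
theorem orderOf_le_of_card_le_two_mul_sub_one (p : ℕ) [CharP F p] {n : ℕ}
    (hF : Fintype.card F ≤ 2 * n - 1) (x : PGL(2, F)) (hx : (orderOf x).Coprime p) :
    orderOf x ≤ 4 * n * (n - 1) := by
  have hq : 1 < Fintype.card F := Fintype.one_lt_card
  obtain ⟨m, rfl⟩ : ∃ m, n = m + 1 := ⟨n - 1, by omega⟩
  have h1 : orderOf x ≤ Fintype.card F ^ 2 - 1 :=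
    Nat.le_of_dvd (Nat.sub_pos_of_lt (Nat.one_lt_pow two_ne_zero hq))
      (orderOf_dvd_card_sq_sub_one p x hx)
  have h2 : Fintype.card F ^ 2 ≤ (2 * (m + 1) - 1) ^ 2 := Nat.pow_le_pow_left hF 2
  have h3 : (2 * (m + 1) - 1) ^ 2 = 4 * (m + 1) * m + 1 := by
    rw [show 2 * (m + 1) - 1 = 2 * m + 1 by omega]
    ring
  have h4 : Fintype.card F ^ 2 - 1 ≤ 4 * (m + 1) * m := Nat.sub_le_of_le_add (h3 ▸ h2)
  simpa using h1.trans h4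

end Prop37

/-! ### Proof of Prop. 3.7: the elementary arithmetic (p. 23, last paragraph – p. 24, l. 10)

Setting (Def. 3.6 and the case `p = q` of the proof of Prop. 3.7): `q, t` primes, `t ∣ q + 1`,
`t > max(10, 8n(n − 1))`, `b = (q + 1)/t > 2`, `a ∈ {1, …, t − 1}` (so that
`ι⁻¹χ|_{I_{ℚ_q}} = ω₂^{a(q−1)b}`), and *"Write `a(q − 1)b = i + (q + 1)j` for some
`i ∈ {1, …, q}`"*.  The printed deductions, in order:
* *"this tame character has niveau 2 since … its order `t` does not divide `q − 1`"* —
  `prop37_not_dvd_sub_one`;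
* such `i ∈ {1, …, q}` and `j` exist — `prop37_exists_eq_add_mul`;
* *"Since `b` divides `i`, `i` is among the numbers `b, 2b, …, q + 1 − b`.  Since `b > 2`, we see
  that neither `i` nor `i − 2` can be divisible by `q − 1`"* — `prop37_dvd_of_eq_add_mul`,
  `prop37_not_dvd`;
* so `(χ₁/χ₂)(Frob_r) = r^{i−1}` cannot be `r` or `r⁻¹` for `r` a primitive root modulo `q`, the
  contradiction proving `r̄_{π,ι}` irreducible — `prop37_zpow_sub_one_ne` (for any group element
  `r` of order `q − 1`);
* *"any `a ∈ {1, …, t − 1}` can be obtained by making a suitable choice of `ι`.  We choose `a` so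
  that `i = b`"* — such an `a` exists, `prop37_exists_a_eq_b`;
* *"the projective image of `r̄_{π,ι}` contains an element of order in the set
  `{(q + 1)/gcd(q + 1, i + 1), (q + 1)/gcd(q + 1, i − 1), (q − 1)/gcd(q − 1, i − 1)}`, therefore of
  order at least `t/2`"* (with `i = b`) — `prop37_le_two_mul_div_gcd_add_one`,
  `prop37_le_two_mul_div_gcd_sub_one`, `prop37_le_two_mul_sub_div_gcd`;
* *"Since `t/2 > 4n(n − 1)`, we see that we must have `q^a > 2n − 1`"* —
  `prop37_two_mul_sub_one_lt_card`, from `orderOf_le_of_card_le_two_mul_sub_one` above.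

(The two appeals to [Gee11, Thm. 4.6.1] and to the classification of finite subgroups of
`PGL₂(𝔽̄_q)` in the same paragraph are statements about `r̄_{π,ι}|_{G_{ℚ_q}}` and Dickson's
theorem; they are not formalized here.)
[cite: NewtonThorneIHES2021b, proof of Prop. 3.7 (pp. 23–24 of arXiv:2009.07180)] -/

section Prop37Arith

/-- `t ∣ q + 1` with `t > 2` forces `t ∤ q − 1` (*"its order `t` does not divide `q − 1`"*, p. 23;
in the source `t` is a prime `> 10`). [cite: NewtonThorneIHES2021b, proof of Prop. 3.7] -/
theorem prop37_not_dvd_sub_one {q t : ℕ} (ht2 : 2 < t) (htq : t ∣ q + 1) :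
    ¬ t ∣ q - 1 := by
  intro h
  rcases Nat.eq_zero_or_pos q with rfl | hq
  · exact absurd (Nat.le_of_dvd Nat.one_pos htq) (by omega)
  · have h2 : t ∣ (q + 1) - (q - 1) := Nat.dvd_sub htq h
    rw [show (q + 1) - (q - 1) = 2 by omega] at h2
    exact absurd (Nat.le_of_dvd two_pos h2) (by omega)

/-- *"Write `a(q − 1)b = i + (q + 1)j` for some `i ∈ {1, …, q}`"* (p. 23): with `q + 1 = tb` and
`a ∈ {1, …, t − 1}`, the residue `i` of `a(q − 1)b` modulo `q + 1` is non-zero, because the prime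
`t` divides neither `a` nor `q − 1`. [cite: NewtonThorneIHES2021b, proof of Prop. 3.7] -/
theorem prop37_exists_eq_add_mul {q t b a : ℕ} (ht : t.Prime) (ht2 : 2 < t)
    (hqt : q + 1 = t * b) (ha : 0 < a) (hat : a < t) :
    ∃ i j : ℕ, 1 ≤ i ∧ i ≤ q ∧ a * (q - 1) * b = i + (q + 1) * j := by
  refine ⟨a * (q - 1) * b % (q + 1), a * (q - 1) * b / (q + 1), ?_, ?_,
    (Nat.mod_add_div _ _).symm⟩
  · rw [Nat.one_le_iff_ne_zero]
    intro h0
    have hb : 0 < b := by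
      rcases Nat.eq_zero_or_pos b with rfl | hb
      · simp at hqt
      · exact hb
    have hdvd : t * b ∣ a * (q - 1) * b := hqt ▸ Nat.dvd_of_mod_eq_zero h0
    rcases (Nat.Prime.dvd_mul ht).mp (Nat.dvd_of_mul_dvd_mul_right hb hdvd) with h | h
    · exact absurd (Nat.le_of_dvd ha h) (not_le.mpr hat)
    · exact prop37_not_dvd_sub_one ht2 ⟨b, hqt⟩ h
  · exact Nat.lt_succ_iff.mp (Nat.mod_lt _ (Nat.succ_pos q))

/-- *"Since `b` divides `i`"* (p. 23): immediate from `a(q − 1)b = i + (q + 1)j` and `b ∣ q + 1`.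
[cite: NewtonThorneIHES2021b, proof of Prop. 3.7] -/
theorem prop37_dvd_of_eq_add_mul {q b a i j : ℕ} (hb : b ∣ q + 1)
    (h : a * (q - 1) * b = i + (q + 1) * j) : b ∣ i := by
  have h1 : b ∣ i + (q + 1) * j := h ▸ Dvd.intro_left _ rfl
  exact (Nat.dvd_add_left (hb.mul_right j)).mp h1

/-- *"`i` is among the numbers `b, 2b, …, q + 1 − b`.  Since `b > 2`, we see that neither `i` nor
`i − 2` can be divisible by `q − 1`"* (p. 23).  (Here `b ∣ i` and `i ≥ 1` give `i ≥ b ≥ 3`, so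
`i − 2 ≥ 1` and natural subtraction is harmless.)
[cite: NewtonThorneIHES2021b, proof of Prop. 3.7] -/
theorem prop37_not_dvd {q b i : ℕ} (hb : b ∣ q + 1) (hb2 : 2 < b) (hbi : b ∣ i) (hi1 : 1 ≤ i)
    (hiq : i ≤ q) : ¬ (q - 1 ∣ i) ∧ ¬ (q - 1 ∣ i - 2) := by
  have hi3 : 3 ≤ i := le_trans hb2 (Nat.le_of_dvd hi1 hbi)
  refine ⟨fun h => ?_, fun h => ?_⟩
  · -- `i = q - 1`, so `b ∣ (q + 1) - (q - 1) = 2`, contradicting `b > 2`.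
    have hi : i = q - 1 := Nat.eq_of_dvd_of_lt_two_mul (by omega) h (by omega)
    subst hi
    have h2 : b ∣ (q + 1) - (q - 1) := Nat.dvd_sub hb hbi
    rw [show (q + 1) - (q - 1) = 2 by omega] at h2
    exact absurd (Nat.le_of_dvd two_pos h2) (by omega)
  · -- `1 ≤ i - 2 ≤ q - 2 < q - 1`.
    exact absurd (Nat.le_of_dvd (by omega) h) (by omega)

/-- **The contradiction proving `r̄_{π,ι}` irreducible** (p. 23): *"we have
`(χ₁/χ₂)(Frob_r) = r^{i−1}`.  Since `π_r` is an unramified twist of the Steinberg representation,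
we have `(χ₁/χ₂)(Frob_r) = r` or `r^{−1}`.  Since `r` is a primitive root modulo `q`, this implies
that one of `i, i − 2` is divisible by `q − 1`"* — which `prop37_not_dvd` forbids.  Stated for any
group element `r` of order `q − 1` (a primitive root modulo `q` is such an element of `(ℤ/qℤ)ˣ`);
the conclusion is symmetric under `r ↦ r⁻¹`, so it does not depend on the Frobenius convention.
[cite: NewtonThorneIHES2021b, proof of Prop. 3.7 (p. 23)] -/
theorem prop37_zpow_sub_one_ne {G : Type*} [Group G] {r : G} {q b i : ℕ}
    (hr : orderOf r = q - 1) (hb : b ∣ q + 1) (hb2 : 2 < b) (hbi : b ∣ i) (hi1 : 1 ≤ i)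
    (hiq : i ≤ q) : r ^ ((i : ℤ) - 1) ≠ r ∧ r ^ ((i : ℤ) - 1) ≠ r⁻¹ := by
  obtain ⟨h1, h2⟩ := prop37_not_dvd hb hb2 hbi hi1 hiq
  have hi3 : 3 ≤ i := le_trans hb2 (Nat.le_of_dvd hi1 hbi)
  refine ⟨fun h => h2 ?_, fun h => h1 ?_⟩
  · have hz : r ^ ((i : ℤ) - 2) = 1 := by
      rw [show (i : ℤ) - 2 = ((i : ℤ) - 1) + (-1) by ring, zpow_add, h, zpow_neg_one,
        mul_inv_cancel]
    have hdvd := orderOf_dvd_iff_zpow_eq_one.mpr hz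
    rw [hr, show (i : ℤ) - 2 = ((i - 2 : ℕ) : ℤ) by omega] at hdvd
    exact Int.natCast_dvd_natCast.mp hdvd
  · have hz : r ^ (i : ℤ) = 1 := by
      rw [show (i : ℤ) = ((i : ℤ) - 1) + 1 by ring, zpow_add, h, zpow_one, inv_mul_cancel]
    have hdvd := orderOf_dvd_iff_zpow_eq_one.mpr hz
    rw [hr] at hdvd
    exact Int.natCast_dvd_natCast.mp hdvd

/-- *"any `a ∈ {1, …, t − 1}` can be obtained by making a suitable choice of `ι`.  We choose `a`
so that `i = b`"* (p. 24, l. 1–2): an exponent `a ∈ {1, …, t − 1}` with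
`a(q − 1)b = b + (q + 1)j` exists — namely `a ≡ (q − 1)⁻¹ ≡ (−2)⁻¹ (mod t)`, a unit because the
prime `t > 2` does not divide `q − 1` (`prop37_not_dvd_sub_one`).
[cite: NewtonThorneIHES2021b, proof of Prop. 3.7 (p. 24)] -/
theorem prop37_exists_a_eq_b {q t b : ℕ} (ht : t.Prime) (ht2 : 2 < t) (hqt : q + 1 = t * b) :
    ∃ a j : ℕ, 0 < a ∧ a < t ∧ a * (q - 1) * b = b + (q + 1) * j := by
  haveI : Fact t.Prime := ⟨ht⟩
  haveI : NeZero t := ⟨ht.ne_zero⟩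
  have hunit : IsUnit ((q - 1 : ℕ) : ZMod t) := by
    rw [ZMod.isUnit_iff_coprime]
    exact ((Nat.Prime.coprime_iff_not_dvd ht).mpr
      (prop37_not_dvd_sub_one ht2 ⟨b, hqt⟩)).symm
  set x : ZMod t := ((q - 1 : ℕ) : ZMod t)⁻¹ with hx
  have hx1 : ((x.val * (q - 1) : ℕ) : ZMod t) = 1 := by
    rw [Nat.cast_mul, ZMod.natCast_zmod_val, hx, ZMod.inv_mul_of_unit _ hunit]
  have hmod : x.val * (q - 1) % t = 1 := by
    have h := (ZMod.natCast_eq_natCast_iff' (x.val * (q - 1)) 1 t).mp (by rw [hx1, Nat.cast_one])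
    rwa [Nat.one_mod_eq_one.mpr ht.one_lt.ne'] at h
  have hdiv : x.val * (q - 1) = 1 + t * (x.val * (q - 1) / t) := by
    conv_lhs => rw [← Nat.mod_add_div (x.val * (q - 1)) t, hmod]
  refine ⟨x.val, x.val * (q - 1) / t, ?_, ZMod.val_lt x, ?_⟩
  · rw [Nat.pos_iff_ne_zero]
    intro h0
    rw [h0, zero_mul, Nat.zero_mod] at hmod
    exact zero_ne_one hmod
  · calc x.val * (q - 1) * b = (1 + t * (x.val * (q - 1) / t)) * b := by rw [← hdiv]
      _ = b + (q + 1) * (x.val * (q - 1) / t) := by rw [hqt]; ring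

/-- First order of the printed set, with `i = b` (p. 24, l. 3–6): for `t` prime and `q + 1 = tb`
with `b ≥ 1`, `(q + 1)/gcd(q + 1, b + 1) ≥ t/2`.  Indeed `gcd(tb, b + 1) = gcd(t, b + 1) ∈ {1, t}`,
and in the second case `t ∣ b + 1`, so the quotient `b` is `≥ t − 1`.
[cite: NewtonThorneIHES2021b, proof of Prop. 3.7 (p. 24)] -/
theorem prop37_le_two_mul_div_gcd_add_one {q t b : ℕ} (ht : t.Prime) (hqt : q + 1 = t * b)
    (hb : 0 < b) : t ≤ 2 * ((q + 1) / Nat.gcd (q + 1) (b + 1)) := by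
  have ht2 := ht.two_le
  rw [hqt]
  have hcop : Nat.Coprime (Nat.gcd (t * b) (b + 1)) b :=
    Nat.Coprime.coprime_dvd_left (Nat.gcd_dvd_right _ _)
      (Nat.coprime_self_add_left.mpr (Nat.coprime_one_left b))
  have hg : Nat.gcd (t * b) (b + 1) ∣ t := hcop.dvd_of_dvd_mul_right (Nat.gcd_dvd_left _ _)
  rcases (Nat.dvd_prime ht).mp hg with h1 | h1
  · rw [h1, Nat.div_one]
    have := Nat.mul_le_mul_left t (show 1 ≤ b from hb)
    omega
  · have htb : t ∣ b + 1 := h1 ▸ Nat.gcd_dvd_right _ _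
    rw [h1, Nat.mul_div_cancel_left b ht.pos]
    have := Nat.le_of_dvd (Nat.succ_pos b) htb
    omega

/-- Second order of the printed set, with `i = b` (p. 24, l. 3–6): for `t` prime and `q + 1 = tb`
with `b ≥ 2`, `(q + 1)/gcd(q + 1, b − 1) ≥ t/2`.  Indeed `gcd(tb, b − 1) = gcd(t, b − 1) ∈ {1, t}`,
and in the second case `t ∣ b − 1 ≥ 1`, so the quotient `b` is `≥ t + 1`.
[cite: NewtonThorneIHES2021b, proof of Prop. 3.7 (p. 24)] -/
theorem prop37_le_two_mul_div_gcd_sub_one {q t b : ℕ} (ht : t.Prime) (hqt : q + 1 = t * b)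
    (hb : 2 ≤ b) : t ≤ 2 * ((q + 1) / Nat.gcd (q + 1) (b - 1)) := by
  have ht2 := ht.two_le
  rw [hqt]
  have hcop : Nat.Coprime (Nat.gcd (t * b) (b - 1)) b :=
    Nat.Coprime.coprime_dvd_left (Nat.gcd_dvd_right _ _)
      ((Nat.coprime_self_sub_right (show 1 ≤ b by omega)).mpr (Nat.coprime_one_right b)).symm
  have hg : Nat.gcd (t * b) (b - 1) ∣ t := hcop.dvd_of_dvd_mul_right (Nat.gcd_dvd_left _ _)
  rcases (Nat.dvd_prime ht).mp hg with h1 | h1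
  · rw [h1, Nat.div_one]
    have := Nat.mul_le_mul_left t (show 1 ≤ b by omega)
    omega
  · have htb : t ∣ b - 1 := h1 ▸ Nat.gcd_dvd_right _ _
    rw [h1, Nat.mul_div_cancel_left b ht.pos]
    have := Nat.le_of_dvd (by omega) htb
    omega

/-- Third order of the printed set, with `i = b` (p. 24, l. 3–6): for `t ≥ 2` and `q + 1 = tb`
with `b ≥ 2`, `(q − 1)/gcd(q − 1, b − 1) ≥ t/2`.  Indeed `gcd(q − 1, b − 1) ≤ b − 1` and
`(q − 1)/(b − 1) = (tb − 2)/(b − 1) ≥ t`.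
[cite: NewtonThorneIHES2021b, proof of Prop. 3.7 (p. 24)] -/
theorem prop37_le_two_mul_sub_div_gcd {q t b : ℕ} (ht : 2 ≤ t) (hqt : q + 1 = t * b)
    (hb : 2 ≤ b) : t ≤ 2 * ((q - 1) / Nat.gcd (q - 1) (b - 1)) := by
  have hb1 : 0 < b - 1 := by omega
  have h1 : t ≤ (q - 1) / (b - 1) := by
    rw [Nat.le_div_iff_mul_le hb1, Nat.mul_sub_one]
    have : t * 2 ≤ t * b := Nat.mul_le_mul_left t hb
    omega
  have h2 : (q - 1) / (b - 1) ≤ (q - 1) / Nat.gcd (q - 1) (b - 1) :=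
    Nat.div_le_div_left (Nat.gcd_le_right _ hb1) (Nat.gcd_pos_of_pos_right _ hb1)
  omega

variable {F : Type*} [Field F] [Fintype F]

open scoped MatrixGroups in
/-- **The closing step of the case `p = q`** (p. 24, l. 6–10): *"the projective image of
`r̄_{π,ι}` contains an element of order … at least `t/2` … If `q^a ≤ 2n − 1` then … every element
of `PGL₂(𝔽_{q^a})` of order prime to `q` has order at most `4n(n − 1)`.  Since `t/2 > 4n(n − 1)`,
we see that we must have `q^a > 2n − 1`."*  Here `F` is a finite field of characteristic `p`
(the source's `q`), `x ∈ PGL₂(F)` has order prime to `p` and `≥ t/2`, and `t > 8n(n − 1)`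
(Def. 3.6 (1)); the conclusion is `|F| > 2n − 1`.
[cite: NewtonThorneIHES2021b, proof of Prop. 3.7 (p. 24)] -/
theorem prop37_two_mul_sub_one_lt_card (p : ℕ) [CharP F p] {n t : ℕ} (x : PGL(2, F))
    (hx : (orderOf x).Coprime p) (htx : t ≤ 2 * orderOf x) (hnt : 8 * n * (n - 1) < t) :
    2 * n - 1 < Fintype.card F := by
  by_contra h
  have hle := orderOf_le_of_card_le_two_mul_sub_one p (not_lt.mp h) x hx
  have h8 : 8 * n * (n - 1) = 2 * (4 * n * (n - 1)) := by ring
  omega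

end Prop37Arith

/-! ### Proof of Prop. 3.9: the image of complex conjugation lies in `[G, G]` (p. 24)

*"Fix a prime `t > max(10, 8n(n − 1), N(π))` such that `t ≡ 1 mod 4` and there exists an
isomorphism `ι : ℚ̄_t → ℂ` such that `G = Proj r̄_{π,ι}(G_ℚ)` is conjugate either to `PSL₂(𝔽_t)`
or `PGL₂(𝔽_t)`.  Since `t > 5`, the group `PSL₂(𝔽_t)` is simple.  The condition `t ≡ 1 mod 4`
implies that `−1 mod t` is a square and that the image of complex conjugation `c` in `G` lies in
`[G, G]`."*  The representation is odd, `det r̄_{π,ι}(c) = −1`; the simplicity of `PSL₂(𝔽_t)` is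
Mathlib's `Matrix.ProjectiveSpecialLinearGroup.rank_two_simple`.  The group theory behind the last
sentence is proved here inside `PGL₂(F)`, `F` a field:
* `mk_mem_range_toPGL_iff` — the image of `g ∈ GL₂(F)` in `PGL₂(F)` lies in the image of `SL₂(F)`
  (i.e. in `PSL₂(F) ⊂ PGL₂(F)`) iff `det g` is a square;
* `range_toPGL_le_commutator` — if `F` has an element `a ≠ 0` with `a² ≠ 1` (e.g. `|F| ≥ 4`), so
  that `SL₂(F)` is perfect (`Matrix.SL2.commutator_eq_top`), then for every subgroup `G` of
  `PGL₂(F)` containing the image of `SL₂(F)` — such as `PSL₂(F)` and `PGL₂(F)` — that image lies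
  in `[G, G]`;
* `prop39_mk_mem_commutator` — hence for `F` finite with `|F| ≡ 1 mod 4` and `det g = −1`
  (`−1` is then a square, `FiniteField.isSquare_neg_one_iff`), the image of `g` lies in `[G, G]`.
[cite: NewtonThorneIHES2021b, proof of Prop. 3.9 (p. 24 of arXiv:2009.07180)] -/

section Prop39

open scoped MatrixGroups

open Matrix

variable {F : Type*} [Field F]

/-- The image of `g ∈ GL₂(F)` in `PGL₂(F)` lies in the image of `SL₂(F) → PGL₂(F)` (that is, in
`PSL₂(F)`) iff `det g` is a square in `Fˣ`. [folklore] -/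
theorem mk_mem_range_toPGL_iff (g : GL (Fin 2) F) :
    ProjGenLinGroup.mk g ∈ (SpecialLinearGroup.toPGL : SL(2, F) →* PGL(2, F)).range ↔
      IsSquare (GeneralLinearGroup.det g) := by
  constructor
  · rintro ⟨s, hs⟩
    rw [SpecialLinearGroup.toPGL, MonoidHom.comp_apply, ProjGenLinGroup.mk_eq_mk_iff] at hs
    obtain ⟨u, hu⟩ := hs
    refine ⟨u, ?_⟩
    have h := congrArg GeneralLinearGroup.det hu
    rw [map_mul, SpecialLinearGroup.coeToGL_det, GeneralLinearGroup.det_scalar, one_mul,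
      Fintype.card_fin] at h
    rw [← h, sq]
  · rintro ⟨u, hu⟩
    have hr : Matrix.det ((u⁻¹ : Fˣ).1 • g.1) = 1 := by
      rw [Matrix.det_smul, Fintype.card_fin, ← GeneralLinearGroup.val_det_apply, hu,
        ← Units.val_pow_eq_pow_val, ← Units.val_mul, ← Units.val_one]
      exact congrArg Units.val (show u⁻¹ ^ 2 * (u * u) = (1 : Fˣ) by group)
    refine ⟨⟨(u⁻¹ : Fˣ).1 • g.1, hr⟩, ?_⟩
    rw [SpecialLinearGroup.toPGL, MonoidHom.comp_apply, ProjGenLinGroup.mk_eq_mk_iff]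
    refine ⟨u, Units.ext ?_⟩
    change ((u⁻¹ : Fˣ).1 • g.1) * Matrix.scalar (Fin 2) (u : F) = g.1
    rw [Matrix.scalar_apply, ← Matrix.smul_one_eq_diagonal, Matrix.mul_smul, Matrix.mul_one,
      smul_smul, Units.mul_inv, one_smul]

/-- For a field `F` having an element `a ≠ 0` with `a² ≠ 1` (equivalently `|F| ∉ {2, 3}`), the
image of `SL₂(F)` in `PGL₂(F)` lies in the commutator subgroup `[G, G]` of every subgroup `G` of
`PGL₂(F)` that contains it: `SL₂(F)` is perfect (`Matrix.SL2.commutator_eq_top`). [folklore] -/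
theorem range_toPGL_le_commutator (hF : ∃ a : F, a ≠ 0 ∧ a ^ 2 ≠ 1) (G : Subgroup PGL(2, F))
    (hG : (SpecialLinearGroup.toPGL : SL(2, F) →* PGL(2, F)).range ≤ G) :
    (SpecialLinearGroup.toPGL : SL(2, F) →* PGL(2, F)).range ≤ ⁅G, G⁆ := by
  obtain ⟨a, ha, hasq⟩ := hF
  have hG' : Subgroup.map (SpecialLinearGroup.toPGL : SL(2, F) →* PGL(2, F)) ⊤ ≤ G := by
    rwa [← MonoidHom.range_eq_map]
  rw [MonoidHom.range_eq_map, ← Matrix.SL2.commutator_eq_top ha hasq, commutator_def,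
    Subgroup.map_commutator]
  exact Subgroup.commutator_mono hG' hG'

/-- **Newton–Thorne II, proof of Prop. 3.9 (p. 24)**: *"The condition `t ≡ 1 mod 4` implies that
`−1 mod t` is a square and that the image of complex conjugation `c` in `G` lies in `[G, G]`."*
Formally: `F` finite with `|F| ≡ 1 mod 4`, `G` a subgroup of `PGL₂(F)` containing the image of
`SL₂(F)` (as `PSL₂(F)` and `PGL₂(F)` do), `g ∈ GL₂(F)` with `det g = −1` (an odd representation
evaluated at complex conjugation); then the image of `g` lies in `[G, G]`.
[cite: NewtonThorneIHES2021b, proof of Prop. 3.9 (p. 24 of arXiv:2009.07180)] -/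
theorem prop39_mk_mem_commutator [Fintype F] (hF : Fintype.card F % 4 = 1)
    (G : Subgroup PGL(2, F))
    (hG : (SpecialLinearGroup.toPGL : SL(2, F) →* PGL(2, F)).range ≤ G)
    (g : GL (Fin 2) F) (hg : GeneralLinearGroup.det g = -1) :
    ProjGenLinGroup.mk g ∈ ⁅G, G⁆ := by
  obtain ⟨r, hr⟩ : IsSquare (-1 : F) := FiniteField.isSquare_neg_one_iff.mpr (by omega)
  have hr0 : r ≠ 0 := by
    rintro rfl
    simp at hr
  have hchar : ringChar F ≠ 2 := fun h2 => by
    have := FiniteField.even_card_iff_char_two.mp h2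
    omega
  have h4 : ∃ a : F, a ≠ 0 ∧ a ^ 2 ≠ 1 :=
    ⟨r, hr0, by rw [sq, ← hr]; exact Ring.neg_one_ne_one_of_char_ne_two hchar⟩
  refine range_toPGL_le_commutator h4 G hG ((mk_mem_range_toPGL_iff g).mpr ⟨Units.mk0 r hr0, ?_⟩)
  ext
  rw [hg, Units.val_mul, Units.val_mk0, Units.val_neg, Units.val_one]
  exact hr

/-! #### `[PGL₂(F), PGL₂(F)] = PSL₂(F)` (proof of Prop. 3.9, p. 25)

On p. 25 the source uses, for `G = Gal(E₂/ℚ) ≅ Proj r̄_{π,ι}(G_ℚ)` conjugate to `PSL₂(𝔽_t)` or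
`PGL₂(𝔽_t)`: *"Let `E₂^{ab}` denote the maximal abelian subfield of `E₂`.  It has degree 1 or 2
over `ℚ` (because of the form of the image of `r̄_{π,ι}`) and `Gal(E₂/E₂^{ab})` is a non-abelian
simple group."*  The group theory: the determinant modulo squares `detModSq : PGL₂(F) →* Fˣ/(Fˣ)²`
is a surjective homomorphism with kernel the image of `SL₂(F)` (`ker_detModSq`), so
`[PGL₂(F), PGL₂(F)] ⊆ im SL₂(F)` (`commutator_le_range_toPGL`), with equality once `|F| ≥ 4`
(`commutator_eq_range_toPGL`); `im SL₂(F) ≅ PSL₂(F)` is simple for `|F| ≥ 4`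
(`Matrix.ProjectiveSpecialLinearGroup.rank_two_simple`), and `PGL₂(F)^{ab} ≅ Fˣ/(Fˣ)²`
(of order `2` for `F` finite of odd characteristic — not needed below and not formalized).
[cite: NewtonThorneIHES2021b, proof of Prop. 3.9 (p. 25 of arXiv:2009.07180)] -/

/-- **Determinant modulo squares**, the homomorphism `PGL₂(F) →* Fˣ ⧸ (Fˣ)²` induced by
`det : GL₂(F) →* Fˣ` (well defined: the scalar matrix `u·1` has determinant `u²`). [folklore] -/
def detModSq : PGL(2, F) →* Fˣ ⧸ (powMonoidHom 2 : Fˣ →* Fˣ).range :=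
  ProjGenLinGroup.lift
    ((QuotientGroup.mk' (powMonoidHom 2 : Fˣ →* Fˣ).range).comp GeneralLinearGroup.det)
    (MonoidHom.ext fun u => by
      rw [MonoidHom.comp_apply, MonoidHom.comp_apply, GeneralLinearGroup.det_scalar,
        Fintype.card_fin, MonoidHom.one_apply, QuotientGroup.mk'_apply, QuotientGroup.eq_one_iff]
      exact ⟨u, rfl⟩)

/-- `detModSq` on the image of `g ∈ GL₂(F)` is `det g` modulo squares. [folklore] -/
@[simp]
theorem detModSq_mk (g : GL (Fin 2) F) :
    detModSq (ProjGenLinGroup.mk g) =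
      ((GeneralLinearGroup.det g : Fˣ) : Fˣ ⧸ (powMonoidHom 2 : Fˣ →* Fˣ).range) :=
  rfl

/-- `detModSq` is surjective (already `det : GL₂(F) → Fˣ` is). [folklore] -/
theorem detModSq_surjective :
    Function.Surjective (detModSq : PGL(2, F) →* Fˣ ⧸ (powMonoidHom 2 : Fˣ →* Fˣ).range) := by
  intro y
  obtain ⟨v, rfl⟩ := QuotientGroup.mk_surjective y
  obtain ⟨g, hg⟩ := GeneralLinearGroup.det_surjective (n := Fin 2) v
  exact ⟨ProjGenLinGroup.mk g, by rw [detModSq_mk, hg]⟩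

/-- The image of `g ∈ GL₂(F)` lies in the kernel of `detModSq` iff `det g` is a square.
[folklore] -/
theorem mk_mem_ker_detModSq_iff (g : GL (Fin 2) F) :
    ProjGenLinGroup.mk g ∈
        (detModSq : PGL(2, F) →* Fˣ ⧸ (powMonoidHom 2 : Fˣ →* Fˣ).range).ker ↔
      IsSquare (GeneralLinearGroup.det g) := by
  rw [MonoidHom.mem_ker, detModSq_mk, QuotientGroup.eq_one_iff, MonoidHom.mem_range]
  constructor
  · rintro ⟨v, hv⟩
    exact ⟨v, by rw [← hv, powMonoidHom_apply, sq]⟩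
  · rintro ⟨v, hv⟩
    exact ⟨v, by rw [powMonoidHom_apply, sq, hv]⟩

/-- `ker (detModSq) = im (SL₂(F) → PGL₂(F))` (`= PSL₂(F)`). [folklore] -/
theorem ker_detModSq :
    (detModSq : PGL(2, F) →* Fˣ ⧸ (powMonoidHom 2 : Fˣ →* Fˣ).range).ker =
      (SpecialLinearGroup.toPGL : SL(2, F) →* PGL(2, F)).range := by
  ext x
  induction x using ProjGenLinGroup.induction_on with
  | mk g => rw [mk_mem_ker_detModSq_iff, mk_mem_range_toPGL_iff]

/-- `[PGL₂(F), PGL₂(F)] ⊆ PSL₂(F)`: a commutator has determinant `1`, a square (equivalently,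
the quotient by the image of `SL₂(F)` is the abelian group `Fˣ/(Fˣ)²`, `ker_detModSq`).
[folklore] -/
theorem commutator_le_range_toPGL :
    commutator PGL(2, F) ≤ (SpecialLinearGroup.toPGL : SL(2, F) →* PGL(2, F)).range := by
  rw [commutator_def, Subgroup.commutator_le]
  rintro x₁ - x₂ -
  induction x₁ using ProjGenLinGroup.induction_on with
  | mk g₁ =>
    induction x₂ using ProjGenLinGroup.induction_on with
    | mk g₂ =>
      rw [← map_commutatorElement, mk_mem_range_toPGL_iff, map_commutatorElement,
        commutatorElement_eq_one_iff_commute.mpr (Commute.all _ _)]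
      exact ⟨1, (mul_one _).symm⟩

/-- **`[PGL₂(F), PGL₂(F)] = PSL₂(F)`** for every field `F` with an element `a ≠ 0`, `a² ≠ 1`
(i.e. `|F| ≥ 4`) — the "form of the image" used on p. 25: for `G = PGL₂(𝔽_t)` the derived
subgroup is `PSL₂(𝔽_t)` (simple for `t ≥ 4`, `Matrix.ProjectiveSpecialLinearGroup.rank_two_simple`)
with abelian quotient `𝔽_tˣ/(𝔽_tˣ)²`; for `G = PSL₂(𝔽_t)` the group is perfect.
[cite: NewtonThorneIHES2021b, proof of Prop. 3.9 (p. 25)] -/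
theorem commutator_eq_range_toPGL (hF : ∃ a : F, a ≠ 0 ∧ a ^ 2 ≠ 1) :
    commutator PGL(2, F) = (SpecialLinearGroup.toPGL : SL(2, F) →* PGL(2, F)).range :=
  le_antisymm commutator_le_range_toPGL
    (by rw [commutator_def]; exact range_toPGL_le_commutator hF ⊤ le_top)

/-! #### `[PGL₂(𝔽_q) : PSL₂(𝔽_q)] = 2` for `q` odd, and `PSL₂` is perfect (proof of Prop. 3.9, p. 25)

The remaining group theory behind *"`E₂^{ab}` … has degree 1 or 2 over `ℚ` (because of the form
of the image of `r̄_{π,ι}`) and `Gal(E₂/E₂^{ab})` is a non-abelian simple group"* (p. 25): for `F`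
finite of odd characteristic the squares have index `2` in `Fˣ` (`index_range_powMonoidHom_two`,
via Mathlib's quadratic character), hence `[PGL₂(F) : PSL₂(F)] = 2` (`index_range_toPGL`, through
`detModSq`); so for `G = PGL₂(F)` the abelianization `G/[G, G] = G/PSL₂(F)` has order `2`
(`commutator_eq_range_toPGL`), while `G = PSL₂(F)` is perfect (`commutator_range_toPGL`, `|F| ≥ 4`)
— in both cases `[G, G] = PSL₂(F)`, simple for `|F| ≥ 4`
(`Matrix.ProjectiveSpecialLinearGroup.rank_two_simple`).
[cite: NewtonThorneIHES2021b, proof of Prop. 3.9 (p. 25 of arXiv:2009.07180)] -/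

/-- `u ∈ Fˣ` is in the image of squaring iff `(u : F)` is a square. [folklore] -/
theorem mem_range_powMonoidHom_two_iff (u : Fˣ) :
    u ∈ (powMonoidHom 2 : Fˣ →* Fˣ).range ↔ IsSquare (u : F) := by
  constructor
  · rintro ⟨v, rfl⟩
    exact ⟨v, by rw [powMonoidHom_apply, Units.val_pow_eq_pow_val, sq]⟩
  · rintro ⟨r, hr⟩
    have hr0 : r ≠ 0 := by
      rintro rfl
      exact u.ne_zero (by rw [hr, mul_zero])
    exact ⟨Units.mk0 r hr0, Units.ext (by
      rw [powMonoidHom_apply, Units.val_pow_eq_pow_val, Units.val_mk0, sq, ← hr])⟩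

/-- **The squares have index `2` in `Fˣ`** for `F` finite of odd characteristic: a non-square `a`
exists (`FiniteField.exists_nonsquare`) and, by multiplicativity of the quadratic character,
exactly one of `b`, `ba` is a square. [folklore] -/
theorem index_range_powMonoidHom_two [Fintype F] [DecidableEq F] (hF : ringChar F ≠ 2) :
    (powMonoidHom 2 : Fˣ →* Fˣ).range.index = 2 := by
  obtain ⟨a, ha⟩ := FiniteField.exists_nonsquare hF
  have ha0 : a ≠ 0 := by
    rintro rfl
    exact ha ⟨0, (mul_zero 0).symm⟩
  have hχa : quadraticChar F a = -1 := quadraticChar_neg_one_iff_not_isSquare.mpr ha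
  rw [Subgroup.index_eq_two_iff]
  refine ⟨Units.mk0 a ha0, fun b => ?_⟩
  rw [mem_range_powMonoidHom_two_iff, mem_range_powMonoidHom_two_iff, Units.val_mul,
    Units.val_mk0]
  have hb0 : (b : F) ≠ 0 := b.ne_zero
  rcases quadraticChar_dichotomy hb0 with hb | hb
  · have h1 : IsSquare (b : F) := (quadraticChar_one_iff_isSquare hb0).mp hb
    have h2 : ¬ IsSquare ((b : F) * a) := quadraticChar_neg_one_iff_not_isSquare.mp (by
      rw [map_mul, hb, hχa, one_mul])
    exact Or.inr ⟨h1, h2⟩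
  · have h1 : ¬ IsSquare (b : F) := quadraticChar_neg_one_iff_not_isSquare.mp hb
    have h2 : IsSquare ((b : F) * a) := (quadraticChar_one_iff_isSquare (mul_ne_zero hb0 ha0)).mp
      (by rw [map_mul, hb, hχa]; norm_num)
    exact Or.inl ⟨h2, h1⟩

/-- **`[PGL₂(F) : PSL₂(F)] = 2`** for `F` finite of odd characteristic: `detModSq` is surjective
with kernel `PSL₂(F)` onto `Fˣ/(Fˣ)²`, of order `2`.  (For `G = PGL₂(𝔽_t)` this is the printed
"degree 2" of `E₂^{ab}`, p. 25, given `commutator_eq_range_toPGL`.)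
[cite: NewtonThorneIHES2021b, proof of Prop. 3.9 (p. 25)] -/
theorem index_range_toPGL [Fintype F] [DecidableEq F] (hF : ringChar F ≠ 2) :
    (SpecialLinearGroup.toPGL : SL(2, F) →* PGL(2, F)).range.index = 2 := by
  rw [← ker_detModSq, Subgroup.index_ker, MonoidHom.range_eq_top.mpr detModSq_surjective,
    Subgroup.card_top, ← Subgroup.index_eq_card]
  exact index_range_powMonoidHom_two hF

/-- **`PSL₂(F)` (the image of `SL₂(F)` in `PGL₂(F)`) is perfect** for `|F| ≥ 4`: for
`G = PSL₂(𝔽_t)` the printed "degree 1" of `E₂^{ab}`, p. 25. [folklore] -/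
theorem commutator_range_toPGL (hF : ∃ a : F, a ≠ 0 ∧ a ^ 2 ≠ 1) :
    ⁅(SpecialLinearGroup.toPGL : SL(2, F) →* PGL(2, F)).range,
      (SpecialLinearGroup.toPGL : SL(2, F) →* PGL(2, F)).range⁆ =
      (SpecialLinearGroup.toPGL : SL(2, F) →* PGL(2, F)).range := by
  refine le_antisymm ?_ (range_toPGL_le_commutator hF _ le_rfl)
  rw [Subgroup.commutator_le]
  intro a ha b hb
  exact Subgroup.mul_mem _ (Subgroup.mul_mem _ (Subgroup.mul_mem _ ha hb) (Subgroup.inv_mem _ ha))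
    (Subgroup.inv_mem _ hb)

end Prop39

/-! #### Complex conjugation fixes the quadratic subfield of `ℚ(ζ_t)`, `t ≡ 1 mod 4` (p. 25)

*"The element `c` also acts trivially on it, since it acts trivially on `E₂^{ab}` and also on the
quadratic subfield of `ℚ(ζ_t)` (since `t ≡ 1 mod 4`)"* (p. 25).  The Galois theory: in a finite
Galois extension every square `τ²` fixes every quadratic subextension (its group has index `2`,
`mem_fixingSubgroup_of_finrank_eq_two`); and in `Gal(ℚ(ζ_t)/ℚ) ≅ (ℤ/tℤ)ˣ` complex conjugation —
the automorphism `ζ ↦ ζ⁻¹`, i.e. `−1` — is a square iff `−1` is a square modulo `t`, which holds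
for `t ≡ 1 mod 4` (`ZMod.exists_sq_eq_neg_one_iff`): `prop39_inv_mem_fixingSubgroup`.
[cite: NewtonThorneIHES2021b, proof of Prop. 3.9 (p. 25 of arXiv:2009.07180)] -/

section Prop39Cyclotomic

/-- In a finite Galois extension `E/F`, a square `τ²` of the Galois group fixes every quadratic
subextension `K` (`Gal(E/K)` has index `[K : F] = 2` and contains all squares). [folklore] -/
theorem mul_self_mem_fixingSubgroup_of_finrank_eq_two {F E : Type*} [Field F] [Field E]
    [Algebra F E] [FiniteDimensional F E] [IsGalois F E] (K : IntermediateField F E)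
    (hK : Module.finrank F K = 2) (τ : E ≃ₐ[F] E) : τ * τ ∈ K.fixingSubgroup := by
  apply Subgroup.mul_self_mem_of_index_two
  have h1 := Subgroup.card_mul_index K.fixingSubgroup
  rw [IsGalois.card_fixingSubgroup_eq_finrank, IsGalois.card_aut_eq_finrank,
    ← Module.finrank_mul_finrank F K E, hK, mul_comm 2] at h1
  exact Nat.eq_of_mul_eq_mul_left Module.finrank_pos h1

/-- **Newton–Thorne II, proof of Prop. 3.9 (p. 25)**: *"`c` acts trivially on the quadratic
subfield of `ℚ(ζ_t)` (since `t ≡ 1 mod 4`)"*.  Formally: `t` a prime with `t ≡ 1 mod 4`, `L/ℚ`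
a `t`-th cyclotomic extension, `σ ∈ Gal(L/ℚ)` the automorphism with `σ ζ = ζ⁻¹` (complex
conjugation, for `L ⊂ ℂ`), `K ⊆ L` a subfield of degree `2` over `ℚ`; then `σ` fixes `K`
pointwise.  Proof: under `Gal(L/ℚ) ≅ (ℤ/tℤ)ˣ` (`IsCyclotomicExtension.autEquivPow`) `σ ↦ −1`, a
square as `t ≡ 1 mod 4`, and squares fix quadratic subextensions.
[cite: NewtonThorneIHES2021b, proof of Prop. 3.9 (p. 25)] -/
theorem prop39_inv_mem_fixingSubgroup {t : ℕ} [hp : Fact t.Prime] (ht : t % 4 = 1)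
    (L : Type*) [Field L] [Algebra ℚ L] [IsCyclotomicExtension {t} ℚ L] (σ : L ≃ₐ[ℚ] L)
    (hσ : σ (IsCyclotomicExtension.zeta t ℚ L) = (IsCyclotomicExtension.zeta t ℚ L)⁻¹)
    (K : IntermediateField ℚ L) (hK : Module.finrank ℚ K = 2) : σ ∈ K.fixingSubgroup := by
  haveI : FiniteDimensional ℚ L := IsCyclotomicExtension.finiteDimensional {t} ℚ L
  haveI : IsGalois ℚ L := IsCyclotomicExtension.isGalois {t} ℚ L
  haveI : NeZero t := ⟨hp.out.ne_zero⟩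
  have hirr : Irreducible (Polynomial.cyclotomic t ℚ) := Polynomial.cyclotomic.irreducible_rat hp.out.pos
  set e := IsCyclotomicExtension.autEquivPow L hirr
  have hζ := IsCyclotomicExtension.zeta_spec t ℚ L
  set ζ := IsCyclotomicExtension.zeta t ℚ L with hζ_def
  -- `σ ↦ -1`
  have hpow : ζ ^ ((-1 : ZMod t).val) = ζ⁻¹ := by
    apply eq_inv_of_mul_eq_one_left
    rw [← pow_succ, hζ.pow_eq_one_iff_dvd, ← ZMod.natCast_eq_zero_iff]
    push_cast
    rw [ZMod.natCast_zmod_val, neg_add_cancel]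
  have he : e σ = -1 := by
    have heσ : e σ = hζ.autToPow ℚ σ := rfl
    apply Units.ext
    apply ZMod.val_injective
    apply hζ.pow_inj (ZMod.val_lt _) (ZMod.val_lt _)
    rw [Units.val_neg, Units.val_one, hpow, heσ, hζ.autToPow_spec ℚ σ, hσ]
  -- `-1` is a square modulo `t`
  obtain ⟨r, hr⟩ : IsSquare (-1 : ZMod t) := ZMod.exists_sq_eq_neg_one_iff.mpr (by omega)
  have hr0 : r ≠ 0 := by
    rintro rfl
    rw [mul_zero] at hr
    exact one_ne_zero (neg_eq_zero.mp hr)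
  have hu : Units.mk0 r hr0 * Units.mk0 r hr0 = -1 :=
    Units.ext (by rw [Units.val_mul, Units.val_mk0, Units.val_neg, Units.val_one, hr])
  have hσ' : σ = e.symm (Units.mk0 r hr0) * e.symm (Units.mk0 r hr0) := by
    apply e.injective
    rw [map_mul, e.apply_symm_apply, hu, he]
  rw [hσ']
  exact mul_self_mem_fixingSubgroup_of_finrank_eq_two K hK _

end Prop39Cyclotomic

/-! #### Two small steps of the proof of Prop. 3.9 (p. 25) and the closing inequality of the proof of Thm. 3.1 (p. 27)

* *"Gal(E₁/ℚ) is soluble and its maximal abelian quotient is a quotient of `(ℤ/2ℤ)²`, so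
  `Gal(E₁ ∩ ℚ(ζ_{p_i})/ℚ)` is a quotient of `(ℤ/2ℤ)²`.  This shows that `E₁ ∩ ℚ(ζ_{p_i})` is either
  trivial or quadratic"* — as `Gal(ℚ(ζ_{p_i})/ℚ) ≅ 𝔽_{p_i}ˣ` is cyclic: a cyclic group of exponent
  dividing `2` has order dividing `2` (`prop39_card_dvd_two`).
* *"Since `(𝔽_{p_i}ˣ)²` contains non-identity elements (because `p_i ≥ 5` …)"* —
  `prop39_exists_sq_ne_one` (`2² = 4 ≠ 1` modulo a prime `≥ 5`).
* Proof of Thm. 3.1, p. 27: *"we must have `3^a > 2n − 1`: otherwise `t ≤ 3^{2a} − 1 ≤ 4n(n − 1)`, a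
  contradiction to our assumption `t > 4n(n − 1)`"* (`t` the order of an element of the projective
  image in `PGL₂(𝔽_{3^a})`, `t ≠ 3` prime) — `thm31_two_mul_sub_one_lt_card`, again from
  `orderOf_le_of_card_le_two_mul_sub_one`.
[cite: NewtonThorneIHES2021b, proofs of Prop. 3.9 (p. 25) and Thm. 3.1 (p. 27)] -/

section Prop39Misc

/-- A cyclic group in which every element squares to `1` (e.g. a cyclic quotient of `(ℤ/2ℤ)²`)
has order dividing `2` — the step *"`E₁ ∩ ℚ(ζ_{p_i})` is either trivial or quadratic"* of the proof
of Prop. 3.9 (p. 25). [cite: NewtonThorneIHES2021b, proof of Prop. 3.9 (p. 25)] -/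
theorem prop39_card_dvd_two {G : Type*} [Group G] [IsCyclic G] (h : ∀ g : G, g * g = 1) :
    Nat.card G ∣ 2 := by
  rw [← IsCyclic.exponent_eq_card, Monoid.exponent_dvd_iff_forall_pow_eq_one]
  intro g
  rw [pow_two, h g]

/-- *"`(𝔽_pˣ)²` contains non-identity elements (because `p ≥ 5`)"* (proof of Prop. 3.9, p. 25):
`2² = 4 ≠ 1` in `𝔽_p` for a prime `p ≥ 5`. [cite: NewtonThorneIHES2021b, proof of Prop. 3.9 (p. 25)] -/
theorem prop39_exists_sq_ne_one {p : ℕ} (hp : p.Prime) (h5 : 5 ≤ p) :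
    ∃ u : (ZMod p)ˣ, u ^ 2 ≠ 1 := by
  have h2 : Nat.Coprime 2 p := (Nat.coprime_primes Nat.prime_two hp).mpr (by omega)
  refine ⟨ZMod.unitOfCoprime 2 h2, fun h => ?_⟩
  have h' : ((2 : ℕ) : ZMod p) ^ 2 = 1 := by
    have := congrArg (fun u : (ZMod p)ˣ => (u : ZMod p)) h
    simpa only [Units.val_pow_eq_pow_val, ZMod.coe_unitOfCoprime, Units.val_one] using this
  have h3 : ((3 : ℕ) : ZMod p) = 0 := by
    push_cast at h' ⊢
    linear_combination h'
  have := Nat.le_of_dvd (by norm_num) ((ZMod.natCast_eq_zero_iff 3 p).mp h3)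
  omega

variable {F : Type*} [Field F] [Fintype F]

open scoped MatrixGroups in
/-- **Proof of Thm. 3.1 (p. 27), the inequality `3^a > 2n − 1`**: *"otherwise
`t ≤ 3^{2a} − 1 ≤ 4n(n − 1)`, a contradiction to our assumption `t > 4n(n − 1)`"*.  Here `F` is a
finite field of characteristic `p` (`= 3` in the source), `x ∈ PGL₂(F)` an element of order prime
to `p` and at least `t`, with `t > 4n(n − 1)`; then `|F| > 2n − 1`.
[cite: NewtonThorneIHES2021b, proof of Thm. 3.1 (p. 27)] -/
theorem thm31_two_mul_sub_one_lt_card (p : ℕ) [CharP F p] {n t : ℕ} (x : PGL(2, F))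
    (hx : (orderOf x).Coprime p) (htx : t ≤ orderOf x) (hnt : 4 * n * (n - 1) < t) :
    2 * n - 1 < Fintype.card F := by
  by_contra h
  have hle := orderOf_le_of_card_le_two_mul_sub_one p (not_lt.mp h) x hx
  omega

end Prop39Misc

end NewtonThorne2021

end Literature.NumberTheory.Automorphic

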